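import Literature.NumberTheory.LFunctions.DeuringHeilbronnSlot
import HarnessLib

/-!
# Deuring–Heilbronn for class group `L`-functions, II: the node sum and the `M`-bound of one character

Topic `Literature/NumberTheory/LFunctions` (namespace `Literature.NumberTheory.LFunctions.NumberField.DH`),
continuing `DeuringHeilbronnSlot.lean`.  Everything here is PROVED (theorems only).

For a class group character `ψ`, `D : SymmHadamardData (Ξ_ψ)`, a point `s` with `1 < Re s` and `μ ≥ 1`:

* `hasSum_slot` — **the explicit formula as a node sum**:
  `Σ_i w_i (s − ω_i)^{−2μ} = 2δ_ψ (s−1)^{−2μ} + 2(1−δ_ψ)((s−1)^{−2μ} + s^{−2μ}) − P_{2μ−1}(ψ, s)`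
  over `i : SlotIdx` (`pairLSeries_explicit` + `hasSum_nodeWt_mul_inv_pow` + `hasSum_trivial`);
* `summable_slotWt_mul_norm`, `tsum_slotWt_mul_norm_le` — **the `M`-bound**
  `Σ_i w_i |s − ω_i|^{−2} ≤ (Re s − 1)^{−1} (Re[2/s + 2/(s−1) + 2γ_K'/γ_K(s)] − Re P_0(ψ, s)) + 2 n_K Z₂`,
  `Z₂ = Σ_{j≥0} (j+1)^{−2}`.

[cite: ThornerZaman2017, §7.1 Lemmas 7.3–7.4, §7.2 (7.7)–(7.8)]

## References

* J. Thorner, A. Zaman, Algebra Number Theory 11 (2017), §7. [ThornerZaman2017]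
-/

noncomputable section

open scoped NumberField
open Complex Filter Topology Set NumberField NumberField.InfinitePlace Classical

namespace Literature.NumberTheory.LFunctions.NumberField

open Literature.NumberTheory.LFunctions.Stark1974

namespace DH

variable {K : Type*} [Field K] [NumberField K]
variable {ψ : ClassGroup (𝓞 K) →* ℂˣ} (D : SymmHadamardData (classXiPair K ψ)) {s : ℂ}

/-! ### Unfolding lemmas -/

/-- Unfolding `slotWt` on the zero slots. [folklore] -/
@[simp] theorem slotWt_inl (p : ℕ × Bool) : slotWt D (Sum.inl p) = D.nodeWt p := rfl
/-- Unfolding `slotWt` on the centre slot. [folklore] -/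
@[simp] theorem slotWt_center (u : Unit) : slotWt D (Sum.inr (Sum.inl u)) = 2 * D.m := rfl
/-- Unfolding `slotWt` on the trivial-zero slots. [folklore] -/
@[simp] theorem slotWt_triv (j : ℕ) : slotWt D (Sum.inr (Sum.inr j)) = trivWt K ψ j := rfl
/-- Unfolding `slotNode` on the zero slots. [folklore] -/
@[simp] theorem slotNode_inl (p : ℕ × Bool) : slotNode D (Sum.inl p) = D.nodeVal p := rfl
/-- Unfolding `slotNode` on the centre slot. [folklore] -/
@[simp] theorem slotNode_center (u : Unit) : slotNode D (Sum.inr (Sum.inl u)) = 1 / 2 := rfl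
/-- Unfolding `slotNode` on the trivial-zero slots. [folklore] -/
@[simp] theorem slotNode_triv (j : ℕ) : slotNode D (Sum.inr (Sum.inr j)) = -(j : ℂ) := rfl

/-! ### The node sum -/

/-- The trivial-zero part of the node sum: `Σ_j w_j (s + j)^{−2μ} = 2G − 2δ_ψ s^{−2μ}`,
`G = Σ_j (r₁(s+2j)^{−2μ} + r₂(s+j)^{−2μ})`. [cite: ThornerZaman2017, §7.2 (7.8)] -/
theorem hasSum_trivWt (ψ : ClassGroup (𝓞 K) →* ℂˣ) (hs : 1 ≤ s.re) {m : ℕ} (hm : 2 ≤ m) :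
    HasSum (fun j : ℕ ↦ (trivWt K ψ j : ℂ) * ((s - (-(j : ℂ))) ^ m)⁻¹)
      (2 * (∑' j : ℕ, ((nrRealPlaces K : ℂ) * ((s + 2 * j) ^ m)⁻¹ + (nrComplexPlaces K : ℂ) * ((s + j) ^ m)⁻¹))
        - 2 * poleInd ψ * (s ^ m)⁻¹) := by
  have h1 := (hasSum_trivial (K := K) hs hm).mul_left (2 : ℂ)
  have h2 : HasSum (fun j : ℕ ↦ if j = 0 then (2 * poleInd ψ * (s ^ m)⁻¹ : ℂ) else 0)
      (2 * poleInd ψ * (s ^ m)⁻¹) := hasSum_ite_eq 0 _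
  refine (h1.sub h2).congr_fun fun j ↦ ?_
  simp only [trivWt, sub_neg_eq_add]
  by_cases hj : j = 0
  · subst hj; simp only [if_true]; push_cast; ring
  · simp only [hj, if_false]; push_cast; ring

/-- **The explicit formula as a node sum.**  For `1 < Re s` and `μ ≥ 1`:
`Σ_i w_i (s − ω_i)^{−2μ} = 2δ_ψ(s−1)^{−2μ} + 2(1−δ_ψ)((s−1)^{−2μ} + s^{−2μ}) − P_{2μ−1}(ψ, s)`.
[cite: ThornerZaman2017, §7.2 (7.7)] -/
theorem hasSum_slot (hs : 1 < s.re) {μ : ℕ} (hμ : 1 ≤ μ) :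
    HasSum (fun i : SlotIdx ↦ (slotWt D i : ℂ) * ((s - slotNode D i) ^ (2 * μ))⁻¹)
      (2 * poleInd ψ * ((s - 1) ^ (2 * μ))⁻¹ +
        2 * (1 - poleInd ψ) * (((s - 1) ^ (2 * μ))⁻¹ + (s ^ (2 * μ))⁻¹) - pairLSeries K ψ (2 * μ - 1) s) := by
  have hΞ := differentiable_classXiPair (K := K) ψ
  have hΞs := classXiPair_ne_zero_of_one_lt_re (K := K) ψ hs
  have hk1 : 1 ≤ 2 * μ - 1 := by omega
  have hk : 2 * μ - 1 + 1 = 2 * μ := by omega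
  -- the three pieces
  have hA : HasSum (fun p : ℕ × Bool ↦ (D.nodeWt p : ℂ) * ((s - D.nodeVal p) ^ (2 * μ))⁻¹)
      (∑' n, D.zeroTerm (2 * μ - 1) s n) := by
    have := D.hasSum_nodeWt_mul_inv_pow hΞ hs hΞs hk1
    rwa [hk] at this
  have hB : HasSum (fun _ : Unit ↦ (2 * D.m : ℂ) * ((s - 1 / 2) ^ (2 * μ))⁻¹)
      ((2 * D.m : ℂ) * ((s - 1 / 2) ^ (2 * μ))⁻¹) := by
    convert hasSum_fintype (fun _ : Unit ↦ (2 * D.m : ℂ) * ((s - 1 / 2) ^ (2 * μ))⁻¹) using 1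
    simp
  have hC := hasSum_trivWt (K := K) ψ hs.le (m := 2 * μ) (by omega)
  have hBC : HasSum ((fun i : SlotIdx ↦ (slotWt D i : ℂ) * ((s - slotNode D i) ^ (2 * μ))⁻¹) ∘ Sum.inr)
      ((2 * D.m : ℂ) * ((s - 1 / 2) ^ (2 * μ))⁻¹ +
        (2 * (∑' j : ℕ, ((nrRealPlaces K : ℂ) * ((s + 2 * j) ^ (2 * μ))⁻¹ +
          (nrComplexPlaces K : ℂ) * ((s + j) ^ (2 * μ))⁻¹)) - 2 * poleInd ψ * (s ^ (2 * μ))⁻¹)) := by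
    refine HasSum.sum ?_ ?_
    · refine hB.congr_fun fun u ↦ ?_
      simp only [Function.comp_apply, slotWt_center, slotNode_center]; push_cast; ring
    · refine hC.congr_fun fun j ↦ ?_
      simp only [Function.comp_apply, slotWt_triv, slotNode_triv]
  have hall := HasSum.sum (f := fun i : SlotIdx ↦ (slotWt D i : ℂ) * ((s - slotNode D i) ^ (2 * μ))⁻¹)
    (hA.congr_fun fun p ↦ by simp only [Function.comp_apply, slotWt_inl, slotNode_inl]) hBC
  convert hall using 1
  rw [pairLSeries_explicit ψ D hs hk1, hk]
  ring

/-! ### The `M`-bound -/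

/-- `Z₂ = Σ_{j ≥ 0} (j+1)^{−2}` (`= π²/6`). [folklore] -/
def zetaTwo : ℝ := ∑' j : ℕ, 1 / ((j : ℝ) + 1) ^ 2

omit [Field K] [NumberField K] in
/-- `0 ≤ Z₂`. [folklore] -/
theorem zetaTwo_nonneg : 0 ≤ zetaTwo := tsum_nonneg fun j ↦ by positivity

/-- The trivial-zero part of the `M`-bound: `Σ_j w_j |s + j|^{−2} ≤ 2 n_K Z₂`, and summability.
[cite: ThornerZaman2017, Lemma 7.3] -/
theorem summable_trivWt_mul_norm (ψ : ClassGroup (𝓞 K) →* ℂˣ) (hs : 1 ≤ s.re) :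
    Summable (fun j : ℕ ↦ trivWt K ψ j * ‖((s - (-(j : ℂ))) ^ 2)⁻¹‖) ∧
      ∑' j : ℕ, trivWt K ψ j * ‖((s - (-(j : ℂ))) ^ 2)⁻¹‖ ≤ 2 * Module.finrank ℚ K * zetaTwo := by
  have hb : Summable fun j : ℕ ↦ 1 / ((j : ℝ) + 1) ^ 2 :=
    Literature.Analysis.SpecialFunctions.Complex.summable_one_div_nat_add_one_sq
  have hle : ∀ j : ℕ, trivWt K ψ j * ‖((s - (-(j : ℂ))) ^ 2)⁻¹‖ ≤
      2 * Module.finrank ℚ K * (1 / ((j : ℝ) + 1) ^ 2) := by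
    intro j
    have hw := trivWt_le (K := K) ψ j
    have hw0 := trivWt_nonneg (K := K) ψ j
    have h1 := one_add_le_norm_add_nat hs j
    have hpos : 0 < 1 + (j : ℝ) := by positivity
    have hn : ‖((s - (-(j : ℂ))) ^ 2)⁻¹‖ ≤ 1 / ((j : ℝ) + 1) ^ 2 := by
      rw [sub_neg_eq_add, norm_inv, norm_pow, one_div]
      apply inv_anti₀ (by positivity)
      rw [add_comm (j : ℝ) 1]
      exact pow_le_pow_left₀ hpos.le h1 2
    calc trivWt K ψ j * ‖((s - (-(j : ℂ))) ^ 2)⁻¹‖ ≤ trivWt K ψ j * (1 / ((j : ℝ) + 1) ^ 2) := by gcongr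
      _ ≤ 2 * Module.finrank ℚ K * (1 / ((j : ℝ) + 1) ^ 2) := by gcongr
  have hsum : Summable (fun j : ℕ ↦ trivWt K ψ j * ‖((s - (-(j : ℂ))) ^ 2)⁻¹‖) :=
    Summable.of_nonneg_of_le (fun j ↦ mul_nonneg (trivWt_nonneg ψ j) (norm_nonneg _)) hle (hb.mul_left _)
  refine ⟨hsum, ?_⟩
  calc ∑' j : ℕ, trivWt K ψ j * ‖((s - (-(j : ℂ))) ^ 2)⁻¹‖
      ≤ ∑' j : ℕ, 2 * Module.finrank ℚ K * (1 / ((j : ℝ) + 1) ^ 2) := hsum.tsum_le_tsum hle (hb.mul_left _)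
    _ = 2 * Module.finrank ℚ K * zetaTwo := by rw [tsum_mul_left]; rfl

/-- **Summability of the node family with exponent `2`.** [cite: ThornerZaman2017, Lemma 7.4] -/
theorem summable_slotWt_mul_norm (hs : 1 < s.re) :
    Summable fun i : SlotIdx ↦ slotWt D i * ‖((s - slotNode D i) ^ 2)⁻¹‖ := by
  have hΞ := differentiable_classXiPair (K := K) ψ
  have hΞs := classXiPair_ne_zero_of_one_lt_re (K := K) ψ hs
  have hA := D.summable_nodeWt_mul_norm_inv_sq hΞ hs hΞs
  have hC := (summable_trivWt_mul_norm (K := K) ψ hs.le).1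
  set F : SlotIdx → ℝ := fun i ↦ slotWt D i * ‖((s - slotNode D i) ^ 2)⁻¹‖ with hF
  have hA' : Summable (F ∘ Sum.inl) := hA.congr fun p ↦ rfl
  have hB' : Summable ((F ∘ Sum.inr) ∘ Sum.inl) := (hasSum_fintype _).summable
  have hC' : Summable ((F ∘ Sum.inr) ∘ Sum.inr) := hC.congr fun j ↦ rfl
  exact Summable.sum F hA' (Summable.sum (F ∘ Sum.inr) hB' hC')

/-- The value at `k = 0`: `Re[2m/(s−½) + Σₙ Zₙ(0,s)] = Re Ξ_ψ'/Ξ_ψ(s)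
 = Re[2/s + 2/(s−1) + 2γ'/γ(s)] − Re P_0(ψ, s)`. [folklore] -/
theorem re_logDeriv_classXiPair_eq (hs : 1 < s.re) :
    (2 * (D.m : ℂ) * (s - 1 / 2)⁻¹ + ∑' n, D.zeroTerm 0 s n).re =
      (2 / s + 2 / (s - 1) + 2 * logDeriv (dedekindGammaFactor K) s).re - (pairLSeries K ψ 0 s).re := by
  have hΞ := differentiable_classXiPair (K := K) ψ
  have hΞs := classXiPair_ne_zero_of_one_lt_re (K := K) ψ hs
  have h0 := D.iteratedDeriv_logDeriv_eq hΞ hΞs 0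
  simp only [iteratedDeriv_zero, pow_zero, Nat.factorial_zero, Nat.cast_one, one_mul, zero_add,
    pow_one] at h0
  rw [← h0, logDeriv_classXiPair ψ hs, logDeriv_classGroupLFunction_eq_neg_LSeries ψ hs,
    logDeriv_classGroupLFunction_eq_neg_LSeries ψ⁻¹ hs, pairLSeries]
  simp only [pow_zero, one_mul, Nat.factorial_zero, Nat.cast_one, div_one, add_re, neg_re, sub_eq_add_neg,
    neg_add]
  ring

/-- **The `M`-bound for one character**: for `1 < Re s`,
`Σ_i w_i |s − ω_i|^{−2} ≤ (Re s − 1)^{−1}(Re[2/s + 2/(s−1) + 2γ'/γ(s)] − Re P_0(ψ,s)) + 2 n_K Z₂`.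
[cite: ThornerZaman2017, Lemmas 7.3–7.4] -/
theorem tsum_slotWt_mul_norm_le (hs : 1 < s.re) :
    ∑' i : SlotIdx, slotWt D i * ‖((s - slotNode D i) ^ 2)⁻¹‖ ≤
      (s.re - 1)⁻¹ * ((2 / s + 2 / (s - 1) + 2 * logDeriv (dedekindGammaFactor K) s).re
        - (pairLSeries K ψ 0 s).re) + 2 * Module.finrank ℚ K * zetaTwo := by
  have hΞ := differentiable_classXiPair (K := K) ψ
  have hΞs := classXiPair_ne_zero_of_one_lt_re (K := K) ψ hs
  have hα : 0 < s.re - 1 := by linarith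
  have hA := D.summable_nodeWt_mul_norm_inv_sq hΞ hs hΞs
  have hAle := D.tsum_nodeWt_mul_norm_inv_sq_le hΞ hs hΞs
  obtain ⟨hC, hCle⟩ := summable_trivWt_mul_norm (K := K) ψ hs.le
  -- split the `tsum` along the index type
  set F : SlotIdx → ℝ := fun i ↦ slotWt D i * ‖((s - slotNode D i) ^ 2)⁻¹‖ with hF
  have hA' : Summable (F ∘ Sum.inl) := hA.congr fun p ↦ rfl
  have hB' : Summable ((F ∘ Sum.inr) ∘ Sum.inl) := (hasSum_fintype _).summable
  have hC' : Summable ((F ∘ Sum.inr) ∘ Sum.inr) := hC.congr fun j ↦ rfl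
  have hsplit : ∑' i : SlotIdx, F i =
      (∑' p : ℕ × Bool, D.nodeWt p * ‖((s - D.nodeVal p) ^ 2)⁻¹‖) +
        ((2 * D.m * ‖((s - 1 / 2) ^ 2)⁻¹‖) + ∑' j : ℕ, trivWt K ψ j * ‖((s - (-(j : ℂ))) ^ 2)⁻¹‖) := by
    rw [Summable.tsum_sum hA' (Summable.sum (F ∘ Sum.inr) hB' hC'),
      show (∑' i : Unit ⊕ ℕ, F (Sum.inr i)) = ∑' i, (F ∘ Sum.inr) i from rfl, Summable.tsum_sum hB' hC']
    simp only [Function.comp_def, hF, slotWt_inl, slotNode_inl, slotWt_center, slotNode_center,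
      slotWt_triv, slotNode_triv, tsum_fintype, Finset.univ_unique, Finset.sum_singleton]
  rw [hsplit]
  -- the centre term
  have hcen : 2 * (D.m : ℝ) * ‖((s - 1 / 2) ^ 2)⁻¹‖ ≤ (s.re - 1)⁻¹ * (2 * (D.m : ℂ) * (s - 1 / 2)⁻¹).re := by
    have h := norm_inv_sq_le_mul_re_inv (s := s) (ρ := 1 / 2) (by norm_num) hs
    have hm : (0 : ℝ) ≤ 2 * D.m := by positivity
    have : (2 * (D.m : ℂ) * (s - 1 / 2)⁻¹).re = 2 * D.m * ((s - 1 / 2)⁻¹).re := by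
      rw [show (2 * (D.m : ℂ)) = ((2 * D.m : ℝ) : ℂ) by push_cast; ring, Complex.re_ofReal_mul]
    rw [this]
    calc 2 * (D.m : ℝ) * ‖((s - 1 / 2) ^ 2)⁻¹‖ ≤ 2 * D.m * ((s.re - 1)⁻¹ * ((s - 1 / 2)⁻¹).re) :=
          mul_le_mul_of_nonneg_left h hm
      _ = (s.re - 1)⁻¹ * (2 * D.m * ((s - 1 / 2)⁻¹).re) := by ring
  have key := re_logDeriv_classXiPair_eq D hs
  rw [add_re] at key
  have htot : (∑' p : ℕ × Bool, D.nodeWt p * ‖((s - D.nodeVal p) ^ 2)⁻¹‖) + 2 * D.m * ‖((s - 1 / 2) ^ 2)⁻¹‖ ≤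
      (s.re - 1)⁻¹ * ((2 / s + 2 / (s - 1) + 2 * logDeriv (dedekindGammaFactor K) s).re - (pairLSeries K ψ 0 s).re) := by
    rw [← key]
    nlinarith [hAle, hcen, inv_pos.mpr hα]
  linarith

/-! ### Removing finitely many node indices -/

/-- The weights with the zero-indices `n ∈ A` (both nodes) and the single nodes `p ∈ B` removed.
[cite: ThornerZaman2017, §7.2 ("ω ≠ β₁")] -/
def slotWt' (A : Finset ℕ) (B : Finset (ℕ × Bool)) : SlotIdx → ℝ
  | Sum.inl p => if p.1 ∈ A then 0 else if p ∈ B then 0 else D.nodeWt p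
  | Sum.inr x => slotWt D (Sum.inr x)

/-- `0 ≤ w' ≤ w`. [folklore] -/
theorem slotWt'_nonneg_le (A : Finset ℕ) (B : Finset (ℕ × Bool)) (i : SlotIdx) :
    0 ≤ slotWt' D A B i ∧ slotWt' D A B i ≤ slotWt D i := by
  rcases i with p | x
  · simp only [slotWt', slotWt_inl]
    split_ifs
    · exact ⟨le_rfl, D.nodeWt_nonneg p⟩
    · exact ⟨le_rfl, D.nodeWt_nonneg p⟩
    · exact ⟨D.nodeWt_nonneg p, le_rfl⟩
  · simp only [slotWt']; exact ⟨slotWt_nonneg D _, le_rfl⟩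

/-- A positive modified weight is `≥ 1`. [folklore] -/
theorem one_le_slotWt'_of_pos (A : Finset ℕ) (B : Finset (ℕ × Bool)) {i : SlotIdx}
    (h : 0 < slotWt' D A B i) : 1 ≤ slotWt' D A B i := by
  rcases i with p | x
  · simp only [slotWt'] at h ⊢
    split_ifs at h ⊢ with h1 h2
    · exact absurd h (lt_irrefl 0)
    · exact absurd h (lt_irrefl 0)
    · exact one_le_slotWt_of_pos D (i := Sum.inl p) h
  · simp only [slotWt'] at h ⊢; exact one_le_slotWt_of_pos D h

/-- A node of positive weight whose value is none of `1, 0` and the removed value `β` keeps a positive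
weight after the removal (when the `A`-indices carry the pair `{1, 0}` and the `B`-indices the value `β`).
[folklore] -/
theorem slotWt'_pos (A : Finset ℕ) (hA : ∀ n ∈ A, D.c n * (1 - 1 / 2) ^ 2 = -1) (B : Finset (ℕ × Bool)) {β : ℂ}
    (hB : ∀ p ∈ B, D.nodeVal p = β) {i : SlotIdx} (h : 0 < slotWt D i) (h1 : slotNode D i ≠ 1)
    (h0 : slotNode D i ≠ 0) (hβ : slotNode D i ≠ β) : 0 < slotWt' D A B i := by
  rcases i with p | x
  · simp only [slotWt', slotNode_inl, slotWt_inl] at h h1 h0 hβ ⊢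
    have hnA : p.1 ∉ A := by
      intro hp
      obtain ⟨b, hb, hb'⟩ := D.nodeVal_pair_of_root (hA p.1 hp)
      rw [sub_self] at hb'
      rcases p with ⟨n, b'⟩
      by_cases hbb : b' = b
      · subst hbb; exact h1 hb
      · have : b' = !b := by cases b <;> cases b' <;> simp_all
        subst this; exact h0 hb'
    have hnB : p ∉ B := fun hp ↦ hβ (hB p hp)
    rw [if_neg hnA, if_neg hnB]; exact h
  · simpa [slotWt'] using h

/-- **The node sum with finitely many indices removed.**  If every `n ∈ A` carries the pair of zeros
`{1, 0}` (`cₙ(1/2)² = −1`) and every `p ∈ B` is a node of weight `1` with value `β` and `p.1 ∉ A`, then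
`Σ_i w'_i (s − ω_i)^{−2μ} = [node sum] − |A|((s−1)^{−2μ} + s^{−2μ}) − |B|(s−β)^{−2μ}`.
[cite: ThornerZaman2017, §7.2 (7.7)–(7.8)] -/
theorem hasSum_slot_removed (hs : 1 < s.re) {μ : ℕ} (hμ : 1 ≤ μ) (A : Finset ℕ)
    (hA : ∀ n ∈ A, D.c n * (1 - 1 / 2) ^ 2 = -1) (B : Finset (ℕ × Bool)) {β : ℂ}
    (hB : ∀ p ∈ B, D.nodeWt p = 1 ∧ D.nodeVal p = β) (hAB : ∀ p ∈ B, p.1 ∉ A) :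
    HasSum (fun i : SlotIdx ↦ (slotWt' D A B i : ℂ) * ((s - slotNode D i) ^ (2 * μ))⁻¹)
      (2 * poleInd ψ * ((s - 1) ^ (2 * μ))⁻¹ +
        2 * (1 - poleInd ψ) * (((s - 1) ^ (2 * μ))⁻¹ + (s ^ (2 * μ))⁻¹) - pairLSeries K ψ (2 * μ - 1) s -
        A.card * (((s - 1) ^ (2 * μ))⁻¹ + (s ^ (2 * μ))⁻¹) - B.card * ((s - β) ^ (2 * μ))⁻¹) := by
  have hfull := hasSum_slot D hs hμ
  -- the removed part, a finite sum
  set f : SlotIdx → ℂ := fun i ↦ (slotWt D i : ℂ) * ((s - slotNode D i) ^ (2 * μ))⁻¹ with hf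
  set g : SlotIdx → ℂ := fun i ↦ (slotWt' D A B i : ℂ) * ((s - slotNode D i) ^ (2 * μ))⁻¹ with hg
  set R₀ : Finset (ℕ × Bool) := A ×ˢ Finset.univ ∪ B with hR₀
  set R : Finset SlotIdx := R₀.map ⟨Sum.inl, Sum.inl_injective⟩ with hR
  have hdiff_zero : ∀ i ∉ R, f i - g i = 0 := by
    intro i hi
    rcases i with p | x
    · have hp : p ∉ R₀ := fun hp ↦ hi (Finset.mem_map.mpr ⟨p, hp, rfl⟩)
      rw [hR₀, Finset.mem_union, Finset.mem_product] at hp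
      push Not at hp
      have h1 : p.1 ∉ A := fun h ↦ hp.1 h (Finset.mem_univ _)
      simp only [hf, hg, slotWt', slotWt_inl, if_neg h1, if_neg hp.2, sub_self]
    · simp only [hf, hg, slotWt', sub_self]
  have hrem : HasSum (fun i ↦ f i - g i) (∑ i ∈ R, (f i - g i)) := hasSum_sum_of_ne_finset_zero hdiff_zero
  -- evaluate the finite sum
  have hk : 2 * μ - 1 + 1 = 2 * μ := by omega
  have hval : ∑ i ∈ R, (f i - g i) =
      A.card * (((s - 1) ^ (2 * μ))⁻¹ + (s ^ (2 * μ))⁻¹) + B.card * ((s - β) ^ (2 * μ))⁻¹ := by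
    rw [hR, Finset.sum_map]
    simp only [Function.Embedding.coeFn_mk]
    have hdisj : Disjoint (A ×ˢ (Finset.univ : Finset Bool)) B := by
      rw [Finset.disjoint_left]
      intro p hp hpB
      exact hAB p hpB (Finset.mem_product.mp hp).1
    rw [hR₀, Finset.sum_union hdisj]
    congr 1
    · -- the `A`-part: `Σ_{n ∈ A} Σ_b w (s−ρ)^{−2μ} = Σ_{n∈A} Zₙ = |A| (B + A')`
      rw [Finset.sum_product]
      have : ∀ n ∈ A, ∑ b : Bool, (f (Sum.inl (n, b)) - g (Sum.inl (n, b))) =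
          ((s - 1) ^ (2 * μ))⁻¹ + (s ^ (2 * μ))⁻¹ := by
        intro n hn
        have hZ := D.zeroTerm_eq_of_root (hA n hn) (2 * μ - 1) s
        rw [hk, sub_self, sub_zero] at hZ
        rw [← hZ, D.zeroTerm_eq_sum_bool, hk]
        refine Finset.sum_congr rfl fun b _ ↦ ?_
        simp only [hf, hg, slotWt', slotWt_inl, slotNode_inl, if_pos hn]
        push_cast; ring
      rw [Finset.sum_congr rfl this, Finset.sum_const, nsmul_eq_mul]
    · have : ∀ p ∈ B, f (Sum.inl p) - g (Sum.inl p) = ((s - β) ^ (2 * μ))⁻¹ := by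
        intro p hp
        obtain ⟨hw, hv⟩ := hB p hp
        simp only [hf, hg, slotWt', slotWt_inl, slotNode_inl, if_neg (hAB p hp), if_pos hp, hw, hv]
        push_cast; ring
      rw [Finset.sum_congr rfl this, Finset.sum_const, nsmul_eq_mul]
  have this := hfull.sub hrem
  rw [hval] at this
  have e : 2 * (poleInd ψ : ℂ) * ((s - 1) ^ (2 * μ))⁻¹ +
        2 * (1 - poleInd ψ) * (((s - 1) ^ (2 * μ))⁻¹ + (s ^ (2 * μ))⁻¹) - pairLSeries K ψ (2 * μ - 1) s -
        A.card * (((s - 1) ^ (2 * μ))⁻¹ + (s ^ (2 * μ))⁻¹) - B.card * ((s - β) ^ (2 * μ))⁻¹ =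
      2 * (poleInd ψ : ℂ) * ((s - 1) ^ (2 * μ))⁻¹ +
        2 * (1 - poleInd ψ) * (((s - 1) ^ (2 * μ))⁻¹ + (s ^ (2 * μ))⁻¹) - pairLSeries K ψ (2 * μ - 1) s -
        (A.card * (((s - 1) ^ (2 * μ))⁻¹ + (s ^ (2 * μ))⁻¹) + B.card * ((s - β) ^ (2 * μ))⁻¹) := by ring
  rw [e]
  exact this.congr_fun fun i ↦ by ring

end DH

end Literature.NumberTheory.LFunctions.NumberField

end
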